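import Summits.BirchSwinnertonDyer.BirchSwinnertonDyer.Theorems.ErratumRoadFiveEulerHalfNotRamInertUpToOneDatumSharp
import HarnessLib

/-!
# Route `ErratumRoadFive` (K2, `p ≥ 5`), crux `EulerHalfNotRamNoInertSetAtFive` (item stmt-BirchSwinnertonDyer-19715), line `birth` v9 → v10:
# THE DATUM LEMMA WITH `2` A GOOD PAIRING PRIME — unless THREE distinct offending split carriers `≠ p` are `≡ 1 (mod p)`, an inert₂ datum or an
# up-to-one₂ datum exists (Papikian–Rabinoff half `∀ q ∈ R, ¬ p ∣ q − 1`); and the v10 residual cut (bookkeeping only)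
# (cell `bsd-stepL`, width seat `bsd-line-er5-p1-w2` g1; `--supports stmt-BirchSwinnertonDyer-19715 --as helper`)

WHAT. The lead's sharp datum lemma p619674 (`inertDatum_or_upToOneDatum_of_not_threeBadOffending`) pins v9's residual to «three distinct offending
split carriers `q_i ≠ p`, each a BAD pairing prime `q_i = 2 ∨ p ∣ q_i − 1`», because v9's inert ∕ up-to-one roads read Pasten's Lemma 6.18 only at
odd pairing primes. With the FULL Lemma 6.18 (`j₂ ∣ 2`, a `p`-adic unit at odd `p`; -w2 g0 p607933) BOTH roads accept `2` in the half: the plain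
inert₂ road `eulerHalfNotRam_of_inertSetDatum₂` (-w2 g0, p609923) and the up-to-one₂ road `res_otherMultUpToOne₂AtFive_of_savedDisplayD_of_lowerX11a`
(-w2 g1, sibling file `…InertUpToOneTwo`). So «bad» shrinks to `p ∣ q − 1`, and the BSD prime `p`, the prime `2` and every offender `q ≢ 1 (mod p)`
may serve in the half. THIS FILE:
* §1 `inertDatum₂_or_upToOneDatum₂_of_not_threeOneModOffending` — unless three distinct offending split carriers `≠ p` with `p ∣ q_i − 1` exist,
  EITHER an even multiplicative `S ∋ p` containing every offender with a half `R ⊆ S`, `∀ q ∈ R, ¬ p ∣ q − 1` (an inert₂ datum, p609923's shape),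
  OR the same with exactly ONE offender `q₁ ∉ S` exempted (an up-to-one₂ datum, the sibling's shape). Same construction as p619674 with
  `good := ¬ p ∣ q − 1`. -- adapted from Summits/BirchSwinnertonDyer/BirchSwinnertonDyer/Theorems/ErratumRoadFiveEulerHalfNotRamInertUpToOneDatumSharp.lean
* §2 `res_otherMultNoSplitDatumAtFive_of_inert₂_of_upToOne₂_of_threeOneModOffending` — v9's S2b shape (`Statement.stub_res_otherMultNoSplitDatumAtFive`:
  X11b ∧ `p ≥ 5` ∧ surj ∧ ¬(ram) ∧ `p ∣ ∏c` ∧ a multiplicative `ℓ ≠ p` ∧ no inert-set datum ∧ no split-set datum ⟹ the Euler-system half) VERBATIM as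
  conclusion, FROM the inert₂ road (∀-form `hI₂`), the up-to-one₂ road (∀-form `hU₂`) and the v10 RESIDUAL `hC3₂` := v9's
  `stub_res_otherMultThreeBadOffendingAtFive` with the bad clause `q_i = 2 ∨ p ∣ q_i − 1` REPLACED BY `p ∣ q_i − 1` and the two excluded data
  («no inert-set datum», «no up-to-one datum») READ WITH THE RELAXED HALF (`∀ q ∈ R, ¬ p ∣ q − 1`) — a strictly smaller class than v9's residual
  (it implies v9's hypotheses: `R`-members `q ≠ 2 ∧ ¬ p ∣ q − 1` are in particular `¬ p ∣ q − 1`). Pure logic + §1.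
CENSUS: v9's residual and this one both have 0 pairs below `5·10⁵` (lead's recount); class-wide the difference is the thin-but-nonempty-in-shape set
of pairs whose only admissible data put `2` in the half (e.g. `Mult(E) = {p, 2, q, m}`, `p` a split carrier, `2, q, m` offending, `q, m ≡ 1 (mod p)`).

HONEST FRAMING: THEOREMS ONLY (finite-set bookkeeping + case split), Theses-free, no `sorry`, no definition, no named fact; nothing about any L-value,
Selmer group or Heegner point is proved here; CONDITIONAL on the displayed ∀-binders in §2; nothing booked; 19715 NOT closed; BSD is proved for no
curve; no summit statement is touched. BARRIER (unchanged): `StringentKolyvaginCapsAtMax` — three offending carriers `≡ 1 (mod p)` leave ≥ 2 Tamagawa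
savings on every Shimura frame or void the pairing half (Jetchev's Conj. 1.2 ∕ Kolyvagin's conjecture at `p ∥ N`, beyond print).
References (locators only): [cite: PastenShimura2024, §6.6, Lemma 6.18 (j_q ∣ q − 1 for odd q, j₂ ∣ 2)] [cite: PapikianRabinoff2016, Cor. 3.5]
[cite: Jetchev2008, Thm. 1.1, Conj. 1.2].
-/

set_option autoImplicit false
set_option linter.dupNamespace false

noncomputable section

open scoped Classical

open WeierstrassCurve Literature.NumberTheory.EllipticCurves.Rank1Residual
  Literature.NumberTheory.EllipticCurves.Rank1Residual.Typed Summit.BirchSwinnertonDyer.Rank1Residual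
  Summit.BirchSwinnertonDyer.Rank1Residual.X11b

namespace Summit.BirchSwinnertonDyer.BirchSwinnertonDyer.Theorems.EulerHalfInertUpToOne

/-! ### §1 The datum lemma with `2` a good pairing prime -/

/-- **Unless three distinct offending split carriers `≠ p` are `≡ 1 (mod p)`, an inert₂ datum or an up-to-one₂ datum exists.**
`W` globally minimal, multiplicative at the prime `p ≥ 5`, some multiplicative prime `≠ p`; offender = split multiplicative `q ≠ p` with `p ∣ ord_q Δ_min`;
bad = `p ∣ q − 1` (so `2` and `p` are good). If NOT (∃ three distinct bad offenders): EITHER an even multiplicative `S ∋ p` containing every offender,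
with a half `R ⊆ S` of primes `q` with `p ∤ q − 1` (the inert₂ datum of `eulerHalfNotRam_of_inertSetDatum₂`), OR the same with exactly ONE offender
`q₁ ∉ S` exempted (the up-to-one₂ datum). Construction: `S = {p} ∪ Off` if `#Off` is odd, else `S = {p} ∪ Off ∖ {e}` with `e` a bad offender if any,
else any offender; `R ⊆ {p} ∪ good offenders` (exists since `#bad ≤ 2`). Bookkeeping only. [cite: PastenShimura2024, Lemma 6.18] [cite: PapikianRabinoff2016, Cor. 3.5] -/
theorem inertDatum₂_or_upToOneDatum₂_of_not_threeOneModOffending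
    (W : WeierstrassCurve ℚ) [W.IsElliptic] [W.IsGloballyMinimal] (p : ℕ) [Fact p.Prime] (hp5 : 5 ≤ p) (hmult : Mult W p)
    (hother : ∃ ℓ : ℕ, ∃ _ : Fact ℓ.Prime, ℓ ≠ p ∧ W.HasMultiplicativeReductionAtPrime ℓ)
    (h3 : ¬ ∃ (q₁ q₂ q₃ : ℕ) (_ : Fact q₁.Prime) (_ : Fact q₂.Prime) (_ : Fact q₃.Prime),
      q₁ ≠ p ∧ q₂ ≠ p ∧ q₃ ≠ p ∧ q₁ ≠ q₂ ∧ q₁ ≠ q₃ ∧ q₂ ≠ q₃ ∧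
      (W.HasSplitMultiplicativeReductionAtPrime q₁ ∧ p ∣ padicValInt q₁ W.minimalDiscriminantInt ∧ p ∣ q₁ - 1) ∧
      (W.HasSplitMultiplicativeReductionAtPrime q₂ ∧ p ∣ padicValInt q₂ W.minimalDiscriminantInt ∧ p ∣ q₂ - 1) ∧
      (W.HasSplitMultiplicativeReductionAtPrime q₃ ∧ p ∣ padicValInt q₃ W.minimalDiscriminantInt ∧ p ∣ q₃ - 1)) :
    (∃ S : Finset ℕ, (∀ ℓ ∈ S, ∃ _ : Fact ℓ.Prime, Mult W ℓ) ∧ Even S.card ∧ p ∈ S ∧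
        (∀ (ℓ : ℕ) [Fact ℓ.Prime], ℓ ∉ S → W.HasSplitMultiplicativeReductionAtPrime ℓ →
          ¬ p ∣ padicValInt ℓ W.minimalDiscriminantInt) ∧
        (¬ p ∣ padicValInt p W.minimalDiscriminantInt ∨
          ∃ R ⊆ S, S.card = 2 * R.card ∧ ∀ q ∈ R, ¬ p ∣ q - 1)) ∨
      (∃ (q₁ : ℕ) (_ : Fact q₁.Prime) (S : Finset ℕ), W.HasSplitMultiplicativeReductionAtPrime q₁ ∧
        p ∣ padicValInt q₁ W.minimalDiscriminantInt ∧
        (∀ ℓ ∈ S, ∃ _ : Fact ℓ.Prime, Mult W ℓ) ∧ Even S.card ∧ p ∈ S ∧ q₁ ∉ S ∧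
        (∀ (ℓ : ℕ) [Fact ℓ.Prime], ℓ ∉ S → ℓ ≠ q₁ → W.HasSplitMultiplicativeReductionAtPrime ℓ →
          ¬ p ∣ padicValInt ℓ W.minimalDiscriminantInt) ∧
        ∃ R ⊆ S, S.card = 2 * R.card ∧ ∀ q ∈ R, ¬ p ∣ q - 1) := by
  have hp := (Fact.out : p.Prime)
  have hpp : ¬ p ∣ p - 1 := fun h ↦ by
    have := Nat.le_of_dvd (by omega) h
    omega
  -- the offenders `≠ p`, a finite set (they divide the conductor)
  set POff : ℕ → Prop := fun q ↦ ∃ _ : Fact q.Prime, q ≠ p ∧ W.HasSplitMultiplicativeReductionAtPrime q ∧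
    p ∣ padicValInt q W.minimalDiscriminantInt with hPOff
  have hN0 : W.conductorNorm ℤ ≠ 0 := Nat.pos_iff_ne_zero.mp (WeierstrassCurve.conductorNorm_pos_holds (W := W))
  set Off : Finset ℕ := (W.conductorNorm ℤ).primeFactors.filter POff with hOffdef
  have memOff : ∀ q : ℕ, q ∈ Off ↔ POff q := by
    intro q
    simp only [hOffdef, Finset.mem_filter, Nat.mem_primeFactors]
    refine ⟨fun h ↦ h.2, fun h ↦ ⟨?_, h⟩⟩
    obtain ⟨hF, -, hs, -⟩ := h
    exact ⟨hF.out, dvd_conductorNorm_of_mult hs.hasMultiplicativeReductionAtPrime, hN0⟩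
  have hpOff : p ∉ Off := fun h ↦ ((memOff p).mp h).2.1 rfl
  set good : ℕ → Prop := fun q ↦ ¬ p ∣ q - 1 with hgood
  -- at most two bad offenders
  have hB2 : (Off.filter (fun q ↦ ¬ good q)).card ≤ 2 := by
    by_contra hlt
    obtain ⟨a, ha, b, hb, c, hc, hab, hac, hbc⟩ :=
      Finset.two_lt_card.mp (show 2 < (Off.filter (fun q ↦ ¬ good q)).card by omega)
    simp only [Finset.mem_filter] at ha hb hc
    obtain ⟨⟨haO, hag⟩, ⟨hbO, hbg⟩, ⟨hcO, hcg⟩⟩ := And.intro ha (And.intro hb hc)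
    obtain ⟨haF, hap, has, had⟩ := (memOff a).mp haO
    obtain ⟨hbF, hbp, hbs, hbd⟩ := (memOff b).mp hbO
    obtain ⟨hcF, hcp, hcs, hcd⟩ := (memOff c).mp hcO
    have bad : ∀ q : ℕ, ¬ good q → p ∣ q - 1 := fun q hq ↦ by
      by_contra hq'
      exact hq hq'
    exact h3 ⟨a, b, c, haF, hbF, hcF, hap, hbp, hcp, hab, hac, hbc, ⟨has, had, bad a hag⟩, ⟨hbs, hbd, bad b hbg⟩,
      ⟨hcs, hcd, bad c hcg⟩⟩
  -- no offender at all: the coarse lemma applies (its halves `q ≠ 2 ∧ ¬ p ∣ q − 1` are in particular `¬ p ∣ q − 1`)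
  by_cases hOff0 : Off = ∅
  · have h3' : ¬ ∃ (q₁ q₂ q₃ : ℕ) (_ : Fact q₁.Prime) (_ : Fact q₂.Prime) (_ : Fact q₃.Prime),
        q₁ ≠ p ∧ q₂ ≠ p ∧ q₃ ≠ p ∧ q₁ ≠ q₂ ∧ q₁ ≠ q₃ ∧ q₂ ≠ q₃ ∧
        W.HasSplitMultiplicativeReductionAtPrime q₁ ∧ p ∣ padicValInt q₁ W.minimalDiscriminantInt ∧
        W.HasSplitMultiplicativeReductionAtPrime q₂ ∧ p ∣ padicValInt q₂ W.minimalDiscriminantInt ∧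
        W.HasSplitMultiplicativeReductionAtPrime q₃ ∧ p ∣ padicValInt q₃ W.minimalDiscriminantInt := by
      rintro ⟨q₁, -, -, hF₁, -, -, h₁p, -, -, -, -, -, h₁s, h₁d, -⟩
      have : q₁ ∈ Off := (memOff q₁).mpr ⟨hF₁, h₁p, h₁s, h₁d⟩
      rw [hOff0] at this
      exact absurd this (Finset.notMem_empty _)
    rcases inertDatum_or_upToOneDatum_of_not_threeOffending W p hp5 hmult hother h3' with
      ⟨S, hSm, hSe, hpS, hFC, hdeg⟩ | ⟨q₁, hF₁, S, hs₁, hd₁, hSm, hSe, hpS, hq₁S, hFC, R, hRS, hcard, hR⟩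
    · refine Or.inl ⟨S, hSm, hSe, hpS, hFC, ?_⟩
      rcases hdeg with hW | ⟨R, hRS, hcard, hR⟩
      · exact Or.inl hW
      · exact Or.inr ⟨R, hRS, hcard, fun q hq ↦ (hR q hq).2⟩
    · exact Or.inr ⟨q₁, hF₁, S, hs₁, hd₁, hSm, hSe, hpS, hq₁S, hFC, R, hRS, hcard, fun q hq ↦ (hR q hq).2⟩
  -- the builder: `S = insert p T` for `T ⊆ Off` with `#T + 1` even and `#T + 1 ≤ 2·(#(T ∩ good) + 1)`
  have build : ∀ T : Finset ℕ, T ⊆ Off → (T.card + 1) % 2 = 0 → T.card + 1 ≤ 2 * ((T.filter good).card + 1) →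
      (∀ ℓ ∈ insert p T, ∃ _ : Fact ℓ.Prime, Mult W ℓ) ∧ Even (insert p T).card ∧ p ∈ insert p T ∧
        ∃ R ⊆ insert p T, (insert p T).card = 2 * R.card ∧ ∀ q ∈ R, ¬ p ∣ q - 1 := by
    intro T hT hpar hle
    have hpT : p ∉ T := fun h ↦ hpOff (hT h)
    have hcard : (insert p T).card = T.card + 1 := Finset.card_insert_of_notMem hpT
    refine ⟨?_, ?_, Finset.mem_insert_self _ _, ?_⟩
    · intro ℓ hℓ
      rcases Finset.mem_insert.mp hℓ with rfl | hℓT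
      · exact ⟨inferInstance, hmult⟩
      · obtain ⟨hF, -, hs, -⟩ := (memOff ℓ).mp (hT hℓT)
        exact ⟨hF, hs.hasMultiplicativeReductionAtPrime⟩
    · rw [hcard, Nat.even_iff]
      exact hpar
    · -- the half: a subset of `insert p (T.filter good)` of size `(#T + 1) / 2`
      have hpG : p ∉ T.filter good := fun h ↦ hpT (Finset.mem_of_mem_filter _ h)
      have hGcard : (insert p (T.filter good)).card = (T.filter good).card + 1 := Finset.card_insert_of_notMem hpG
      obtain ⟨R, hRsub, hRcard⟩ := Finset.exists_subset_card_eq (s := insert p (T.filter good))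
        (n := (T.card + 1) / 2) (by rw [hGcard]; omega)
      refine ⟨R, hRsub.trans (Finset.insert_subset_insert _ (Finset.filter_subset _ _)), by rw [hcard, hRcard]; omega, ?_⟩
      intro q hq
      rcases Finset.mem_insert.mp (hRsub hq) with rfl | hqG
      · exact hpp
      · exact (Finset.mem_filter.mp hqG).2
  -- counting: #Off = #good + #bad, #bad ≤ 2
  have hsplit : (Off.filter good).card + (Off.filter (fun q ↦ ¬ good q)).card = Off.card :=
    Finset.card_filter_add_card_filter_not _
  have hOffpos : 0 < Off.card := Finset.card_pos.mpr (Finset.nonempty_iff_ne_empty.mpr hOff0)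
  rcases Nat.even_or_odd Off.card with hev | hodd
  · -- `#Off` even: exempt one offender `e` (bad if possible), `T = Off.erase e`
    have hev' : Off.card % 2 = 0 := Nat.even_iff.mp hev
    -- choose `e`
    have hex : ∃ e ∈ Off, (Off.filter (fun q ↦ ¬ good q)).card ≤ ((Off.erase e).filter good).card + 1 + 1 ∧
        ((Off.erase e).filter good).card + 1 ≥ (Off.card) / 2 := by
      by_cases hB0 : (Off.filter (fun q ↦ ¬ good q)) = ∅
      · -- no bad offender: exempt any offender
        obtain ⟨e, he⟩ := Finset.nonempty_iff_ne_empty.mpr hOff0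
        have hB : (Off.filter (fun q ↦ ¬ good q)).card = 0 := by rw [hB0]; rfl
        have hGe : ((Off.erase e).filter good).card + 1 ≥ (Off.filter good).card := by
          have : (Off.filter good) ⊆ insert e ((Off.erase e).filter good) := by
            intro q hq
            rcases eq_or_ne q e with rfl | hne
            · exact Finset.mem_insert_self _ _
            · exact Finset.mem_insert_of_mem (Finset.mem_filter.mpr
                ⟨Finset.mem_erase.mpr ⟨hne, Finset.mem_of_mem_filter _ hq⟩, (Finset.mem_filter.mp hq).2⟩)
          exact (Finset.card_le_card this).trans (Finset.card_insert_le _ _)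
        refine ⟨e, he, by omega, ?_⟩
        omega
      · obtain ⟨e, he⟩ := Finset.nonempty_iff_ne_empty.mpr hB0
        have heO : e ∈ Off := Finset.mem_of_mem_filter _ he
        have hebad : ¬ good e := (Finset.mem_filter.mp he).2
        -- erasing a BAD offender keeps every good one
        have hGe : ((Off.erase e).filter good).card = (Off.filter good).card := by
          congr 1
          ext q
          simp only [Finset.mem_filter, Finset.mem_erase]
          constructor
          · rintro ⟨⟨-, hq⟩, hg⟩; exact ⟨hq, hg⟩
          · rintro ⟨hq, hg⟩
            refine ⟨⟨?_, hq⟩, hg⟩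
            rintro rfl; exact hebad hg
        refine ⟨e, heO, by omega, ?_⟩
        omega
    obtain ⟨e, heO, -, hge⟩ := hex
    obtain ⟨heF, hep, hes, hed⟩ := (memOff e).mp heO
    have hTcard : (Off.erase e).card = Off.card - 1 := Finset.card_erase_of_mem heO
    have hpar : ((Off.erase e).card + 1) % 2 = 0 := by
      rw [hTcard]; omega
    have hle : (Off.erase e).card + 1 ≤ 2 * (((Off.erase e).filter good).card + 1) := by
      rw [hTcard]; omega
    obtain ⟨hmemS, hevenS, hpS, hR⟩ := build (Off.erase e) (Finset.erase_subset _ _) hpar hle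
    refine Or.inr ⟨e, heF, insert p (Off.erase e), hes, hed, hmemS, hevenS, hpS, ?_, ?_, hR⟩
    · simp only [Finset.mem_insert, Finset.mem_erase, not_or, not_and]
      exact ⟨hep, fun h _ ↦ h rfl⟩
    · intro ℓ _ hℓS hℓe hℓs hℓd
      apply hℓS
      simp only [Finset.mem_insert, Finset.mem_erase]
      rcases eq_or_ne ℓ p with rfl | hℓp
      · exact Or.inl rfl
      · exact Or.inr ⟨hℓe, (memOff ℓ).mpr ⟨inferInstance, hℓp, hℓs, hℓd⟩⟩
  · -- `#Off` odd: take every offender, `T = Off`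
    have hpar : (Off.card + 1) % 2 = 0 := by rw [Nat.odd_iff] at hodd; omega
    have hle : Off.card + 1 ≤ 2 * ((Off.filter good).card + 1) := by
      rw [Nat.odd_iff] at hodd; omega
    obtain ⟨hmemS, hevenS, hpS, hR⟩ := build Off le_rfl hpar hle
    refine Or.inl ⟨insert p Off, hmemS, hevenS, hpS, ?_, Or.inr hR⟩
    intro ℓ _ hℓS hℓs hℓd
    apply hℓS
    simp only [Finset.mem_insert]
    rcases eq_or_ne ℓ p with rfl | hℓp
    · exact Or.inl rfl
    · exact Or.inr ((memOff ℓ).mpr ⟨inferInstance, hℓp, hℓs, hℓd⟩)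

/-! ### §2 v9's S2b shape from the inert₂ road, the up-to-one₂ road and the v10 residual «three offending carriers ≡ 1 (mod p)» -/

/-- **S2b of line `birth` (`Statement.stub_res_otherMultNoSplitDatumAtFive`: X11b ∧ `p ≥ 5` ∧ surj ∧ ¬(ram) ∧ `p ∣ ∏c` ∧ a multiplicative `ℓ ≠ p`
∧ no inert-set datum ∧ no split-set datum ⟹ `Typed.MissingUpperBoundAt W p`), VERBATIM as conclusion, BY CASES on the relaxed data:** an inert₂
datum → the inert₂ road (`hI₂`, ∀-form = -w2 g0's `eulerHalfNotRam_of_inertSetDatum₂` conclusion); an up-to-one₂ datum → the up-to-one₂ road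
(`hU₂`, ∀-form = `res_otherMultUpToOne₂AtFive_of_savedDisplayD_of_lowerX11a`'s conclusion); three distinct offending split carriers `≡ 1 (mod p)` →
the v10 RESIDUAL `hC3₂` (v9's `stub_res_otherMultThreeBadOffendingAtFive` with bad clause `p ∣ q_i − 1` and the excluded inert ∕ up-to-one data
read with the relaxed half); otherwise §1 contradicts. The crux's own «no inert-set datum» hypothesis (half `q ≠ 2 ∧ ¬ p ∣ q − 1`) is not used.
Pure logic; CONDITIONAL on the three ∀-binders; nothing booked. [cite: PastenShimura2024, Lemma 6.18] [cite: Jetchev2008, Conj. 1.2] -/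
theorem res_otherMultNoSplitDatumAtFive_of_inert₂_of_upToOne₂_of_threeOneModOffending
    (hI₂ : ∀ (W : WeierstrassCurve ℚ) [W.IsElliptic] [W.IsGloballyMinimal] (p : ℕ) [Fact p.Prime],
      ClassX11b W p → 5 ≤ p → Surj W p → ¬ Ram W p →
        (∃ S : Finset ℕ, (∀ ℓ ∈ S, ∃ _ : Fact ℓ.Prime, Mult W ℓ) ∧ Even S.card ∧ p ∈ S ∧
          (∀ (ℓ : ℕ) [Fact ℓ.Prime], ℓ ∉ S → W.HasSplitMultiplicativeReductionAtPrime ℓ →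
            ¬ p ∣ padicValInt ℓ W.minimalDiscriminantInt) ∧
          (¬ p ∣ padicValInt p W.minimalDiscriminantInt ∨
            ∃ R ⊆ S, S.card = 2 * R.card ∧ ∀ q ∈ R, ¬ p ∣ q - 1)) →
          Typed.MissingUpperBoundAt W p)
    (hU₂ : ∀ (W : WeierstrassCurve ℚ) [W.IsElliptic] [W.IsGloballyMinimal] (p : ℕ) [Fact p.Prime],
      ClassX11b W p → 5 ≤ p → Surj W p → ¬ Ram W p →
      (∃ (q₁ : ℕ) (_ : Fact q₁.Prime) (S : Finset ℕ), W.HasSplitMultiplicativeReductionAtPrime q₁ ∧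
        p ∣ padicValInt q₁ W.minimalDiscriminantInt ∧
        (∀ ℓ ∈ S, ∃ _ : Fact ℓ.Prime, Mult W ℓ) ∧ Even S.card ∧ p ∈ S ∧ q₁ ∉ S ∧
        (∀ (ℓ : ℕ) [Fact ℓ.Prime], ℓ ∉ S → ℓ ≠ q₁ → W.HasSplitMultiplicativeReductionAtPrime ℓ →
          ¬ p ∣ padicValInt ℓ W.minimalDiscriminantInt) ∧
        ∃ R ⊆ S, S.card = 2 * R.card ∧ ∀ q ∈ R, ¬ p ∣ q - 1) →
      Typed.MissingUpperBoundAt W p)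
    (hC3₂ : ∀ (W : WeierstrassCurve ℚ) [W.IsElliptic] [W.IsGloballyMinimal] (p : ℕ) [Fact p.Prime],
      ClassX11b W p → 5 ≤ p → Surj W p → ¬ Ram W p → p ∣ W.tamagawaProduct →
      (∃ ℓ : ℕ, ∃ _ : Fact ℓ.Prime, ℓ ≠ p ∧ W.HasMultiplicativeReductionAtPrime ℓ) →
      (∃ (q₁ q₂ q₃ : ℕ) (_ : Fact q₁.Prime) (_ : Fact q₂.Prime) (_ : Fact q₃.Prime),
        q₁ ≠ p ∧ q₂ ≠ p ∧ q₃ ≠ p ∧ q₁ ≠ q₂ ∧ q₁ ≠ q₃ ∧ q₂ ≠ q₃ ∧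
        (W.HasSplitMultiplicativeReductionAtPrime q₁ ∧ p ∣ padicValInt q₁ W.minimalDiscriminantInt ∧ p ∣ q₁ - 1) ∧
        (W.HasSplitMultiplicativeReductionAtPrime q₂ ∧ p ∣ padicValInt q₂ W.minimalDiscriminantInt ∧ p ∣ q₂ - 1) ∧
        (W.HasSplitMultiplicativeReductionAtPrime q₃ ∧ p ∣ padicValInt q₃ W.minimalDiscriminantInt ∧ p ∣ q₃ - 1)) →
      ¬ (∃ S : Finset ℕ, (∀ ℓ ∈ S, ∃ _ : Fact ℓ.Prime, Mult W ℓ) ∧ Even S.card ∧ p ∈ S ∧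
          (∀ (ℓ : ℕ) [Fact ℓ.Prime], ℓ ∉ S → W.HasSplitMultiplicativeReductionAtPrime ℓ →
            ¬ p ∣ padicValInt ℓ W.minimalDiscriminantInt) ∧
          (¬ p ∣ padicValInt p W.minimalDiscriminantInt ∨
            ∃ R ⊆ S, S.card = 2 * R.card ∧ ∀ q ∈ R, ¬ p ∣ q - 1)) →
      ¬ (∃ S : Finset ℕ, (∀ ℓ ∈ S, ∃ _ : Fact ℓ.Prime, Mult W ℓ) ∧ Even S.card ∧ p ∉ S ∧
          (∀ (ℓ : ℕ) [Fact ℓ.Prime], ℓ ∉ S → W.HasSplitMultiplicativeReductionAtPrime ℓ →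
            ¬ p ∣ padicValInt ℓ W.minimalDiscriminantInt) ∧
          ((∃ (ℓ₀ : ℕ) (_ : Fact ℓ₀.Prime), Mult W ℓ₀ ∧ ℓ₀ ≠ p ∧ ¬ p ∣ padicValInt ℓ₀ W.minimalDiscriminantInt) ∨
            ∃ R ⊆ S, S.card = 2 * R.card ∧ ∀ q ∈ R, ¬ p ∣ q - 1)) →
      ¬ (∃ (q₁ : ℕ) (_ : Fact q₁.Prime) (S : Finset ℕ), W.HasSplitMultiplicativeReductionAtPrime q₁ ∧
          p ∣ padicValInt q₁ W.minimalDiscriminantInt ∧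
          (∀ ℓ ∈ S, ∃ _ : Fact ℓ.Prime, Mult W ℓ) ∧ Even S.card ∧ p ∈ S ∧ q₁ ∉ S ∧
          (∀ (ℓ : ℕ) [Fact ℓ.Prime], ℓ ∉ S → ℓ ≠ q₁ → W.HasSplitMultiplicativeReductionAtPrime ℓ →
            ¬ p ∣ padicValInt ℓ W.minimalDiscriminantInt) ∧
          ∃ R ⊆ S, S.card = 2 * R.card ∧ ∀ q ∈ R, ¬ p ∣ q - 1) →
      Typed.MissingUpperBoundAt W p) :
    ∀ (W : WeierstrassCurve ℚ) [W.IsElliptic] [W.IsGloballyMinimal] (p : ℕ) [Fact p.Prime],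
      ClassX11b W p → 5 ≤ p → Surj W p → ¬ Ram W p → p ∣ W.tamagawaProduct →
      (∃ ℓ : ℕ, ∃ _ : Fact ℓ.Prime, ℓ ≠ p ∧ W.HasMultiplicativeReductionAtPrime ℓ) →
      ¬ (∃ S : Finset ℕ, (∀ ℓ ∈ S, ∃ _ : Fact ℓ.Prime, Mult W ℓ) ∧ Even S.card ∧ p ∈ S ∧
          (∀ (ℓ : ℕ) [Fact ℓ.Prime], ℓ ∉ S → W.HasSplitMultiplicativeReductionAtPrime ℓ →
            ¬ p ∣ padicValInt ℓ W.minimalDiscriminantInt) ∧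
          (¬ p ∣ padicValInt p W.minimalDiscriminantInt ∨
            ∃ R ⊆ S, S.card = 2 * R.card ∧ ∀ q ∈ R, q ≠ 2 ∧ ¬ p ∣ q - 1)) →
      ¬ (∃ S : Finset ℕ, (∀ ℓ ∈ S, ∃ _ : Fact ℓ.Prime, Mult W ℓ) ∧ Even S.card ∧ p ∉ S ∧
          (∀ (ℓ : ℕ) [Fact ℓ.Prime], ℓ ∉ S → W.HasSplitMultiplicativeReductionAtPrime ℓ →
            ¬ p ∣ padicValInt ℓ W.minimalDiscriminantInt) ∧
          ((∃ (ℓ₀ : ℕ) (_ : Fact ℓ₀.Prime), Mult W ℓ₀ ∧ ℓ₀ ≠ p ∧ ¬ p ∣ padicValInt ℓ₀ W.minimalDiscriminantInt) ∨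
            ∃ R ⊆ S, S.card = 2 * R.card ∧ ∀ q ∈ R, ¬ p ∣ q - 1)) →
      Typed.MissingUpperBoundAt W p := by
  intro W _ _ p _ hX hp5 hsurj hnram htam hother _hnoI hnoD
  by_cases hI : ∃ S : Finset ℕ, (∀ ℓ ∈ S, ∃ _ : Fact ℓ.Prime, Mult W ℓ) ∧ Even S.card ∧ p ∈ S ∧
      (∀ (ℓ : ℕ) [Fact ℓ.Prime], ℓ ∉ S → W.HasSplitMultiplicativeReductionAtPrime ℓ →
        ¬ p ∣ padicValInt ℓ W.minimalDiscriminantInt) ∧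
      (¬ p ∣ padicValInt p W.minimalDiscriminantInt ∨
        ∃ R ⊆ S, S.card = 2 * R.card ∧ ∀ q ∈ R, ¬ p ∣ q - 1)
  · exact hI₂ W p hX hp5 hsurj hnram hI
  by_cases hU : ∃ (q₁ : ℕ) (_ : Fact q₁.Prime) (S : Finset ℕ), W.HasSplitMultiplicativeReductionAtPrime q₁ ∧
      p ∣ padicValInt q₁ W.minimalDiscriminantInt ∧
      (∀ ℓ ∈ S, ∃ _ : Fact ℓ.Prime, Mult W ℓ) ∧ Even S.card ∧ p ∈ S ∧ q₁ ∉ S ∧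
      (∀ (ℓ : ℕ) [Fact ℓ.Prime], ℓ ∉ S → ℓ ≠ q₁ → W.HasSplitMultiplicativeReductionAtPrime ℓ →
        ¬ p ∣ padicValInt ℓ W.minimalDiscriminantInt) ∧
      ∃ R ⊆ S, S.card = 2 * R.card ∧ ∀ q ∈ R, ¬ p ∣ q - 1
  · exact hU₂ W p hX hp5 hsurj hnram hU
  by_cases h3 : ∃ (q₁ q₂ q₃ : ℕ) (_ : Fact q₁.Prime) (_ : Fact q₂.Prime) (_ : Fact q₃.Prime),
      q₁ ≠ p ∧ q₂ ≠ p ∧ q₃ ≠ p ∧ q₁ ≠ q₂ ∧ q₁ ≠ q₃ ∧ q₂ ≠ q₃ ∧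
      (W.HasSplitMultiplicativeReductionAtPrime q₁ ∧ p ∣ padicValInt q₁ W.minimalDiscriminantInt ∧ p ∣ q₁ - 1) ∧
      (W.HasSplitMultiplicativeReductionAtPrime q₂ ∧ p ∣ padicValInt q₂ W.minimalDiscriminantInt ∧ p ∣ q₂ - 1) ∧
      (W.HasSplitMultiplicativeReductionAtPrime q₃ ∧ p ∣ padicValInt q₃ W.minimalDiscriminantInt ∧ p ∣ q₃ - 1)
  · exact hC3₂ W p hX hp5 hsurj hnram htam hother h3 hI hnoD hU
  · rcases inertDatum₂_or_upToOneDatum₂_of_not_threeOneModOffending W p hp5 hX.2.2.1 hother h3 with hI' | hU'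
    · exact absurd hI' hI
    · exact absurd hU' hU

end Summit.BirchSwinnertonDyer.BirchSwinnertonDyer.Theorems.EulerHalfInertUpToOne

end
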